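import Mathlib

/-!
# (M5) SIMULTANEOUS MARKOV SELECTION — plate t50-S of nsreg-p2 ROUND-47 «WHO HOLDS THE RIDGE»
(`r47/Sketch47.lean` sha16 c5b0bf755040b563, text VERBATIM)

Width piece for crux `EulerZoomLiouville.PowerGaugeEulerLiouville` (stmt-NavierStokesRegularity-19832), by name under
LEAD 19832 (successor of ns-typeII-p2 g13) and planner nsreg-p2 g37; seat ns-ezl-w2 g5,
`--supports stmt-NavierStokesRegularity-19832 --as helper`.

* `markovSelection` = `NsregP2.R47.MarkovSelection` (M5): `n` continuous non-negative functions `gᵢ` on `[a,b]`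
  (`a < b`) have a common point `t` where each is at most `n ×` its mean: `gᵢ(t)(b−a) ≤ n∫_a^b gᵢ` for all `i`
  (minimise the continuous function `Σᵢ gᵢ/∫gᵢ`, whose integral is `≤ n`; a `gᵢ` with zero integral vanishes on
  `[a,b]`).  Use in ROUND-47: the choice of the returned radius `d ∈ [s^{3/4}, 2s^{3/4}]` good for three circle
  functionals at once (`n = 3`).

HONEST FRAMING: elementary one-variable analysis on the MODEL lattice of crux E; proves nothing about the crux
(19832 OPEN), about `Sig.stub_selfSimilarC2Needle`, about THEOREM K⁗, or about Navier–Stokes regularity; no hard core is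
touched. [folklore]
-/

noncomputable section

open Set Filter Topology Metric Function MeasureTheory Real

set_option linter.dupNamespace false

namespace Summit.NavierStokesRegularity.NavierStokesRegularity.Theorems.PowerGaugeEulerLiouville.Condenser

/-! ## (M5) Simultaneous Markov selection -/

/-- **(M5) SIMULTANEOUS MARKOV SELECTION**, working form.  `n` continuous non-negative functions `gᵢ` on `[a,b]`
(`a < b`) have a common point `t` with `gᵢ(t)(b−a) ≤ n ∫_a^b gᵢ` for every `i`.
Proof: with `cᵢ = ∫_a^b gᵢ` and weights `1/cᵢ` (or `0` when `cᵢ = 0`, in which case `gᵢ ≡ 0` on `[a,b]`), the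
continuous function `F = Σᵢ gᵢ/cᵢ` attains its minimum at some `t`, where `F(t)(b−a) ≤ ∫_a^b F ≤ n`. [folklore] -/
theorem markovSelection_of {n : ℕ} {g : Fin n → ℝ → ℝ} {a b : ℝ} (hab : a < b)
    (hgc : ∀ i, ContinuousOn (g i) (Icc a b)) (hg0 : ∀ i, ∀ t ∈ Icc a b, 0 ≤ g i t) :
    ∃ t ∈ Icc a b, ∀ i, g i t * (b - a) ≤ n * (∫ s in a..b, g i s) := by
  set c : Fin n → ℝ := fun i => ∫ s in a..b, g i s with hc
  have hc0 : ∀ i, 0 ≤ c i := fun i => intervalIntegral.integral_nonneg hab.le (hg0 i)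
  have hgi : ∀ i, IntervalIntegrable (g i) volume a b := fun i => (hgc i).intervalIntegrable_of_Icc hab.le
  set wt : Fin n → ℝ := fun i => if 0 < c i then (c i)⁻¹ else 0 with hwt
  have hwt0 : ∀ i, 0 ≤ wt i := fun i => by
    simp only [hwt]; split_ifs with h
    · exact inv_nonneg.2 h.le
    · exact le_rfl
  have hwtc : ∀ i, wt i * c i ≤ 1 := fun i => by
    simp only [hwt]; split_ifs with h
    · rw [inv_mul_cancel₀ h.ne']
    · rw [zero_mul]; exact zero_le_one
  set F : ℝ → ℝ := fun t => ∑ i, wt i * g i t with hF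
  have hFc : ContinuousOn F (Icc a b) :=
    continuousOn_finsetSum _ fun i _ => continuousOn_const.mul (hgc i)
  obtain ⟨t₀, ht₀, hmin⟩ := isCompact_Icc.exists_isMinOn (nonempty_Icc.2 hab.le) hFc
  refine ⟨t₀, ht₀, fun i => ?_⟩
  have hFint : ∫ s in a..b, F s = ∑ i, wt i * c i := by
    simp only [hF]
    rw [intervalIntegral.integral_finsetSum fun i _ => (hgi i).const_mul _]
    refine Finset.sum_congr rfl fun i _ => ?_
    rw [intervalIntegral.integral_const_mul]
  have hFle : F t₀ * (b - a) ≤ ∑ i, wt i * c i := by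
    have h1 : ∫ _ in a..b, F t₀ = (b - a) * F t₀ := by
      rw [intervalIntegral.integral_const, smul_eq_mul]
    have h2 : ∫ _ in a..b, F t₀ ≤ ∫ s in a..b, F s :=
      intervalIntegral.integral_mono_on hab.le intervalIntegrable_const (hFc.intervalIntegrable_of_Icc hab.le)
        fun s hs => (isMinOn_iff.1 hmin) s hs
    rw [h1, hFint] at h2
    linarith
  have hsum_le : ∑ i, wt i * c i ≤ n := by
    calc ∑ i, wt i * c i ≤ ∑ _i : Fin n, (1 : ℝ) := Finset.sum_le_sum fun i _ => hwtc i
      _ = n := by simp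
  by_cases hci : 0 < c i
  · have hterm : wt i * g i t₀ ≤ F t₀ := by
      simp only [hF]
      exact Finset.single_le_sum (f := fun j => wt j * g j t₀)
        (fun j _ => mul_nonneg (hwt0 j) (hg0 j t₀ ht₀)) (Finset.mem_univ i)
    have hwi : wt i = (c i)⁻¹ := by simp [hwt, hci]
    have hne : c i ≠ 0 := hci.ne'
    calc g i t₀ * (b - a) = (c i * (c i)⁻¹) * g i t₀ * (b - a) := by rw [mul_inv_cancel₀ hne, one_mul]
      _ = c i * (wt i * g i t₀ * (b - a)) := by rw [hwi]; ring
      _ ≤ c i * (F t₀ * (b - a)) :=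
          mul_le_mul_of_nonneg_left (mul_le_mul_of_nonneg_right hterm (by linarith)) hci.le
      _ ≤ c i * n := mul_le_mul_of_nonneg_left (hFle.trans hsum_le) hci.le
      _ = n * c i := mul_comm _ _
  · have hci0 : c i = 0 := le_antisymm (not_lt.1 hci) (hc0 i)
    have hgi0 : g i t₀ ≤ 0 := by
      by_contra hpos
      push Not at hpos
      have hlt : ∫ _ in a..b, (0 : ℝ) < ∫ s in a..b, g i s :=
        intervalIntegral.integral_lt_integral_of_continuousOn_of_le_of_exists_lt hab continuousOn_const (hgc i)
          (fun s hs => hg0 i s (Ioc_subset_Icc_self hs)) ⟨t₀, ht₀, hpos⟩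
      rw [intervalIntegral.integral_zero] at hlt
      exact absurd hci0 hlt.ne'
    have hz : g i t₀ = 0 := le_antisymm hgi0 (hg0 i t₀ ht₀)
    rw [hz, zero_mul]
    exact mul_nonneg n.cast_nonneg (hc0 i)

/-- **(M5) `NsregP2.R47.MarkovSelection`, binder-for-binder** (Sketch47 of nsreg-p2 g37, plate t50-M5).
Use in ROUND-47 (choice of the returned radius `d ∈ [d₁, 2d₁]`, `d₁ = s^{3/4}`, `n = 3`): `g₁ = ρ⨍_{S_ρ}‖V∘Φ‖²`,
`g₂ = ρ⨍_{S_ρ}|P′∘Φ − P′(0)|`, `g₃ = ρ⨍_{S_ρ}‖DV∘Φ‖²`. [folklore] -/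
theorem markovSelection :
    ∀ (n : ℕ) (g : Fin n → ℝ → ℝ) (a b : ℝ), a < b → (∀ i, ContinuousOn (g i) (Icc a b)) →
      (∀ i, ∀ t ∈ Icc a b, 0 ≤ g i t) →
      ∃ t ∈ Icc a b, ∀ i, g i t * (b - a) ≤ n * (∫ s in a..b, g i s) :=
  fun _ _ _ _ hab hgc hg0 => markovSelection_of hab hgc hg0

end Summit.NavierStokesRegularity.NavierStokesRegularity.Theorems.PowerGaugeEulerLiouville.Condenser

end
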